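import Summits.Ventures.PercRepro.RankLevelSetHallRepairRank

/-!
# PercRepro — THE TOURNAMENT CONJECTURE AT THE DIAGONAL CELLS `(q + 2, q)` (night-1, gen 15; dossier §26.8)

`spadeInjection_of_repair_rank` (RankLevelSetHallRepairRank) turns a tournament of repair sets — repair sets `W S ⊆ E` of
size `p − #S` outside `cl S`, with one of any two sets of ℛ whose union has rank `< p` keeping its repair set out of the
closure of the other — into the injection (♠′), hence into the UP-Hall condition of C-044 at the tight layer.  THIS FILE names
the existence of such a tournament as a `Prop` (`RepairTournament M p q`, NOT asserted) and records the conjecture of record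
for the diagonal cells, where `k = p − q = 2` and every repair set is a single element:
**(T2) every finite matroid with `#E = 2q + 2` admits a repair tournament for the cell `(q + 2, q)`** (`RepairTournamentDiag`).
Evidence (night-1 g15, own exact code tournament.py / randcov.py, dossier §26.7–26.8): a (flat-level) tournament exists on EVERY
loopless matroid at the tight layer of a diagonal cell on ≤ 8 elements (`(4,2)`: 17 / 17, `(5,3)`: 276 / 276 — 192 by a reservoir,
84 by the refined tournament) and on every random structured instance computed — `(5,3)` n = 8: 263 / 263, `(6,4)` n = 10:
291 / 291, `(7,5)` n = 12: 83 / 83 decided (1 undecided at the node cap) — while at `k = 3` (`(6,3)` on 9 elements) tournaments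
are NOT sufficient (26 simple matroids have (♠′) only by a cyclic matching).  With `hallUp_of_ncard_eq_of_repair_rank`, (T2)
gives C-044 in both Hall forms at the tight layer of EVERY diagonal cell for every finite matroid (the DOWN form is
`hallDown_of_ncard_eq`); Rule Q gave the same modulo the unproved binomial lemma (L) of §23.7.  Nothing here is proved beyond
the implication.

* `RepairTournament` — the `Prop` «a tournament of repair sets exists for the cell `(p, q)` of `M`»;
* `RepairTournamentDiag` — the conjecture (T2): every finite matroid with `#E = 2q + 2`, every `q ≥ 1`;
* **`hallUp_of_ncard_eq_of_repairTournament`** — `#E = p + q` and `RepairTournament M p q` ⇒ the UP-Hall condition for every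
  family of members;
* `hallUp_diag_of_repairTournamentDiag` — (T2) ⇒ the UP-Hall condition of C-044 at the tight layer of every diagonal cell.
Axioms: standard.
-/

namespace PercRepro

open Set Matroid

variable {α : Type}

/-- **A tournament of repair sets exists** for the cell `(p, q)` of `M` (a `Prop`, NOT asserted): repair sets `W S ⊆ E` of
size `p − #S` outside `cl S` for the sets `S` of ℛ, such that of any two sets of ℛ whose union has rank `< p`, one keeps its
repair set out of the closure of the other. -/
def RepairTournament (M : Matroid α) (p q : ℕ) : Prop :=
  ∃ W : Set α → Set α,
    (∀ S ∈ rankqOver M p q, W S ⊆ M.E) ∧ (∀ S ∈ rankqOver M p q, (W S).ncard = p - S.ncard) ∧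
    (∀ S ∈ rankqOver M p q, ∀ w ∈ W S, M.eRk (insert w S) ≠ (q : ℕ∞)) ∧
    (∀ S₁ ∈ rankqOver M p q, ∀ S₂ ∈ rankqOver M p q, M.eRk (S₁ ∪ S₂) < (p : ℕ∞) →
      (∀ w ∈ W S₁, M.eRk (insert w S₂) ≠ (q : ℕ∞)) ∨ (∀ w ∈ W S₂, M.eRk (insert w S₁) ≠ (q : ℕ∞)))

/-- **The conjecture (T2)** (a `Prop`, NOT asserted): every finite matroid at the tight layer of a diagonal cell
`(q + 2, q)` admits a tournament of repair sets. -/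
def RepairTournamentDiag : Prop :=
  ∀ {α : Type} (M : Matroid α), M.Finite → ∀ q : ℕ, 1 ≤ q → M.E.ncard = (q + 2) + q → RepairTournament M (q + 2) q

/-- **C-044, UP FORM, AT THE TIGHT LAYER FROM A REPAIR TOURNAMENT**. -/
theorem hallUp_of_ncard_eq_of_repairTournament (M : Matroid α) [M.Finite] (p q : ℕ) (hE : M.E.ncard = p + q)
    (h : RepairTournament M p q) (𝒜 : Set (Set α)) (h𝒜 : 𝒜 ⊆ cellMembers M p q) :
    phiK p q * (𝒜.ncard : ℚ) ≤ ((upNbhd M p q 𝒜).ncard : ℚ) := by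
  obtain ⟨W, hWE, hWcard, hWcl, htour⟩ := h
  exact hallUp_of_ncard_eq_of_repair_rank M p q hE W hWE hWcard hWcl htour 𝒜 h𝒜

/-- **(T2) gives the UP form of C-044 at the tight layer of every diagonal cell** (`#E = 2q + 2`, `q ≥ 1`), for every finite
matroid and every family of members. -/
theorem hallUp_diag_of_repairTournamentDiag (hT : RepairTournamentDiag) (M : Matroid α) [hf : M.Finite] (q : ℕ)
    (hq : 1 ≤ q) (hE : M.E.ncard = (q + 2) + q) (𝒜 : Set (Set α)) (h𝒜 : 𝒜 ⊆ cellMembers M (q + 2) q) :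
    phiK (q + 2) q * (𝒜.ncard : ℚ) ≤ ((upNbhd M (q + 2) q 𝒜).ncard : ℚ) :=
  hallUp_of_ncard_eq_of_repairTournament M (q + 2) q hE (hT M hf q hq hE) 𝒜 h𝒜

end PercRepro
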